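import Mathlib.NumberTheory.Padics.PadicVal.Basic
import Literature.NumberTheory.EllipticCurves.BSDInvariants
import HarnessLib

/-!
# The `p`-part of the BSD formula in analytic rank `≤ 1` beyond Skinner–Urban: multiplicative `p`
(Skinner 2016), analytic rank one at good ordinary `p` (Jetchev–Skinner–Wan 2017), and Wuthrich's
unconditional divisibility (2014)

Literature reproduction file (typed statements with citation headers; LEAN-IN-TREE rule of
2026-08-18). Three (since 2026-08-19: four) published theorems on the `p`-primary part of the
Birch–Swinnerton-Dyer formula
for elliptic curves `E/ℚ` of analytic rank `0` or `1`, vendored as NAMED FACTS in exactly the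
currency of the tree's **bsd.S30** `Literature.NumberTheory.EllipticCurves.padicValRat_bsd_rank_zero`
(`LeadingTerm.lean`; Skinner–Urban 2014 Thm. 2 (a)): the invariants are those of
`BSDInvariants` (`W.realPeriodRat = Ω_E = ∫_{E(ℝ)}|ω|` on a globally minimal `W`, including the
number of real components; `W.regulator`; `W.tamagawaProduct = ∏_ℓ c_ℓ`; `W.shaOrder = #Ш(E/ℚ)`
with `Finite W.sha` carried as a hypothesis exactly as in bsd.S30 — it is a THEOREM in analytic
rank `≤ 1`, bsd.S17 `rank_eq_analyticRank_of_analyticRank_le_one`, not an extra assumption of the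
sources; `W.torsionOrder = #E(ℚ)_tors`; `W.leadingLCoeff = L^{(r)}(E,1)/r!`, so `= L'(E,1)` when
`W.analyticRank = 1`), the reduction types are `WeierstrassCurve.HasGoodReductionAtPrime` /
`HasMultiplicativeReductionAtPrime` (`Tamagawa.lean`) and `W.IsSemistable ℤ`
(`LocalReduction.lean`), "good ordinary" is `p ∤ a_p` with `a_p = W.frobeniusTrace p`
(`GlobalMinimalModel.lean`), the image conditions are `W.HasIrreducibleModPGaloisRep p` /
`W.HasSurjectiveModNGaloisRep p` (`GaloisAction.lean`), and — as in bsd.S30 (`haux`) — "`E[p]` is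
ramified at the multiplicative prime `q ≠ p`" is transcribed through Tate's parametrisation as
`p ∤ v_q(Δ_min)` (for `q` of multiplicative reduction, `q ≠ p`, `ρ̄_{E,p}` is unramified at `q`
iff `p ∣ v_q(Δ_min)`; Serre, Invent. Math. 15 (1972) §1.12 / Prop. 4; Silverman, *ATAEC* V.4–V.5).

These are the statements behind the theorem rows `T-SK`, `T-JSW` and the lever `L1` (= proposed
row `T-WU14`) of the BSD-to-conductor-`N` census (`run/shared/lean/speedrun/kurihara/bsdN/
HYPOTHESES.md`) and of `RESIDUAL-CASES.md` §(a) of the bsd-percentage bundle; the lane's per-curve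
records cite the rows by tag, and this file gives the tags tree anchors. Nothing here is proved:
each `def … : Prop` is a faithful transcription of a refereed theorem (net literature debt `+3`,
`+4` with W. Zhang 2014);
none restates bsd.S30 (different hypotheses: multiplicative `p`; analytic rank `1`; no image /
ramification hypothesis at all in Wuthrich's divisibility).

## What is vendored, and what deliberately is not

* **`Skinner2016_padicValRat_bsd_rank_zero`** — C. Skinner, *Multiplicative reduction and the
  cyclotomic main conjecture for GL₂*, Pacific J. Math. 283 (2016) 171–200, **Thm. C (p. 173)**,
  first half (`L(E,1) ≠ 0`), as printed: good ordinary OR multiplicative `p ≥ 3`, `E[p]`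
  irreducible, a multiplicative prime `q ≠ p` at which `E[p]` is ramified. (The second half,
  "`L(E,1) = 0 ⇒ corank_{ℤ_p} Sel_{p^∞}(E) ≥ 1`", is not a leading-term statement and is left out.)
* **NOT vendored: Castella 2018, Thm. A at `p ∣ N`** — F. Castella, *On the `p`-part of the
  Birch–Swinnerton-Dyer formula for multiplicative primes*, Camb. J. Math. 6 (2018) 1–23, Thm. A
  (pp. 1–2): semistable `E`, `ord_{s=1} L(E,s) = 1`, `p > 3`, `ρ̄_{E,p}` irreducible, and for
  `p ∣ N` "`E[p]` ramified at some prime `q ≠ p`" ⇒ `ord_p(L'(E,1)/(Reg·Ω_E)) = ord_p(#Ш ∏_{ℓ∣N} c_ℓ)`.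
  For `p ∤ N` this "was first established by Jetchev–Skinner–Wan" (p. 2) = the next item; the case
  `p ∣ N` ("the main novelty", p. 2; lane row `T-CAS`) was typed here in the first version of this
  file (p177363) and is WITHDRAWN in this version: the author's erratum (F. Castella, *Erratum to
  "On the `p`-part of the Birch–Swinnerton-Dyer formula for multiplicative primes"*, web-only, n.d.,
  `https://web.math.ucsb.edu/~castella/Birch-erratum.pdf`, p. 1) states that "the existence of a
  point `φ ∈ X_I^a` as used in the proof of [Cas18, Thm. 4.2] is not guaranteed in general. This
  affects the proof of [op. cit., Thm. 4.4]. In the case `p ‖ N` … Theorem 4.4 in [Cas18] should be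
  replaced by Theorem 1.1 below" and that "Theorem A′ … should replace the main Theorem A in op.
  cit. when `p ‖ N`" — Thm. A′: multiplicative `p > 3`, `ρ̄_{E,p}` irreducible, a NONSPLIT
  multiplicative `q ≠ p` with `E[p]` ramified at `q`, and `E(ℚ_p)[p] = 0` (semistability dropped) —
  whose proof rests on "[FW21, Thm. 4.41]" = Fouquet–Wan, arXiv:2107.13726 (preprint). So the
  printed proof of Thm. A at `p ∣ N` is withdrawn by its author and the replacement A′ is not yet in
  refereed print: neither is a Literature fact under the rule that the cited source PROVES the
  statement (cf. the bsd-percentage AUDIT.md §G1, which read the erratum in full, and the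
  follow-on cell's X11 audit of 2026-08-18).
  -- TODO(general form): Castella's Thm. A′ (erratum Thm. 1.1 = Castella, arXiv:2409.01360 Thm. 3.1)
  -- once Fouquet–Wan Thm. 4.41 is in refereed print; hypotheses as quoted above.
* **`JetchevSkinnerWan2017_padicValRat_bsd_rank_one_ordinary`** — D. Jetchev, C. Skinner, X. Wan,
  *The Birch and Swinnerton-Dyer formula for elliptic curves of analytic rank one*, Camb. J. Math.
  5 (2017) 369–434, **Thm. 1.2.1 (p. 370)**, RESTRICTED to primes of good ORDINARY reduction
  (`p ∤ a_p`). The printed theorem also covers good supersingular `p` (`p ≥ 5`, and `p = 3` when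
  `a_3 = 0`), but that case invokes "Wan's recent work on Kobayashi's supersingular variant of the
  Iwasawa main conjecture [wan:rankin-ss]/[wan:kobayashi]" (p. 371 and §7.4.4 (iii)) = X. Wan,
  arXiv:1411.6352, a preprint later withdrawn from publication ("superseded by part of the new
  preprint 2409.01350", arXiv v9 comment; Burungale–Skinner–Tian–Wan, arXiv:2409.01350, Rem. 1.4 (i):
  "no longer intended for publication"), so under the house rule that a Literature fact cites a
  source that PROVES it the supersingular case is not vendored here.
  -- TODO(general form): the supersingular case of JSW Thm. 1.2.1, once the signed main conjecture
  -- it rests on (BSTW 2024, Thm. 1.3) is in refereed print.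
* **`Wuthrich2014_shaOrder_dvd_of_L_one_ne_zero`** — C. Wuthrich, *On the integrality of modular
  symbols and Kato's Euler system for elliptic curves*, Doc. Math. 19 (2014) 381–402,
  **Prop. 21 (p. 400)**, as printed (no hypothesis on `p`, the reduction or the image: the
  exceptional primes are absorbed in the constant `C`).
* **`WZhang2014_padicValRat_bsd_rank_one_ordinary`** (added 2026-08-19, literature seat of the
  bsd-percentage cell) — W. Zhang, *Selmer groups and the indivisibility of Heegner points*, Camb.
  J. Math. 2 (2014) 191–253, **Thm. 1.6 (p. 199)** with the hypotheses (1)–(4) of **Thm. 1.4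
  (p. 197)** and the standing assumptions of p. 193 (`ρ̄_{E,p}` surjective, `p ∤ N`, `p ≥ 5`), as
  printed: the `p`-part of the formula in analytic rank one at a good ORDINARY prime `p ≥ 5`, for a
  curve of ARBITRARY conductor (no semistability), proved by the Heegner-point Kolyvagin-system
  method (the paper's Thm. 1.1, Gross–Zagier in the form of Yuan–Zhang–Zhang, Kolyvagin, and the
  rank-zero theorem of Kato and Skinner–Urban for a quadratic twist — Remark 5, p. 199); it uses no
  Beilinson–Flach element. This is the row `C5` / lever `L4` statement of `RESIDUAL-CASES.md` and
  the Beilinson–Flach-free rank-one input of the bsd-percentage `PERCENT-FULL.md` line "full BSD at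
  every good ordinary prime". Hypothesis (2) ("if `ℓ ≡ ±1 mod p` and `ℓ ∥ N` then `ρ̄_{E,p}` is
  ramified at `ℓ`") and the set `Ram(ρ̄_{E,p})` of hypothesis (3) are transcribed through Tate's
  parametrisation exactly as `haux`/`hram` above (`ℓ ∥ N` = multiplicative reduction at `ℓ`;
  ramified ⟺ `p ∤ v_ℓ(Δ_min)`, Bhargava–Skinner–Zhang 2014 Remark 7); "`N` is not square-free" =
  `¬ W.IsSemistable ℤ`. Zhang's regulator `Reg(E/ℚ) := ⟨y,y⟩_{NT}/[E(ℚ):ℤy]²` (any non-torsion `y`)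
  equals `W.regulator / #E(ℚ)_tors²` in rank one, so the printed identity carries the torsion term;
  it is kept (a `p`-adic unit under (1), but nothing is dropped).

Conventions checked against the sources: Skinner's `Ω_E` is "the canonical period" of S–U
(= bsd.S30's `Ω_E`); JSW (1.1.a), p. 370: "`Ω_E = ∫_{E(ℝ)}|ω_E|` for `ω_E` a Néron differential";
Wuthrich p. 382: "`Ω⁺_E` [is] the minimal
absolute value of non-zero elements in `L_E` on the real axis" (the Néron lattice) and Prop. 21
counts "the number of components in `E(ℝ)`" as `c_∞` among the `c_v`, so that
`(L(E,1)/Ω⁺_E)/c_∞ = L(E,1)/Ω_E` with the tree's `Ω_E = c_∞ Ω⁺_E` — the transcription below uses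
`W.realPeriodRat` and the finite Tamagawa product, which is the printed quantity on the nose.
At an odd `p` a power of `2` in the period is in any case immaterial to the two valuation
statements.

History: v1 (p177363, 2026-08-18) also declared `Castella2018_padicValRat_bsd_rank_one_multiplicative`
(Thm. A at `p ∣ N`); removed the same day, before any use, on account of the author's erratum
(see above) — net debt of the file `+4 → +3`.

## References

* C. Skinner, Pacific J. Math. 283 (2016) 171–200, Thm. C (p. 173); §2.5 (pp. 180–181) for the
  removal of the `SL₂(ℤ_p)`-image hypothesis of Skinner–Urban. [Skinner2016PacificMC]
* F. Castella, Camb. J. Math. 6 (2018) 1–23, Thm. A (pp. 1–2), with the author's web erratum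
  (n.d.), Thm. A′ / Thm. 1.1 — cited for what is NOT vendored. [Castella2018]
* D. Jetchev, C. Skinner, X. Wan, Camb. J. Math. 5 (2017) 369–434, Thm. 1.2.1 (p. 370), §7.4.4
  (remarks on the hypotheses). [JetchevSkinnerWan2017]
* C. Wuthrich, Doc. Math. 19 (2014) 381–402, Prop. 21 (p. 400); §1 p. 382 (periods `Ω^±_E`).
  [Wuthrich2014]
* C. Skinner, E. Urban, Invent. Math. 195 (2014), Thm. 2 — the tree's bsd.S30. [SkinnerUrban2014]
* J.-P. Serre, Invent. Math. 15 (1972), §1.12 and §4 Prop. 4 (Tate curves: ramification of `E[p]`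
  at a multiplicative prime). [Serre1972]
* W. Zhang, Camb. J. Math. 2 (2014) 191–253, Thm. 1.4 (p. 197), Remark 3 (p. 198), Thm. 1.6
  (p. 199), Remarks 4–5 (p. 199); standing hypotheses p. 193. [WZhang2014]
* M. Bhargava, C. Skinner, W. Zhang, arXiv:1407.1826 (2014), Remark 7 (ramification of `E[p]` at
  `ℓ ∥ N` ⟺ `p ∤ ord_ℓ(Δ_ℓ)`). [BhargavaSkinnerZhang2014]
-/

noncomputable section

open scoped Classical

open WeierstrassCurve

namespace Literature.NumberTheory.EllipticCurves

section PPartRankLeOne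

/-- **Skinner 2016, Thm. C (rank-`0` half)** — C. Skinner, Pacific J. Math. 283 (2016) 171–200
(title in the module docstring), Thm. C, p. 173, a THEOREM, verbatim:
"Let `E` be an elliptic curve over `ℚ` with good ordinary or multiplicative reduction at a prime
`p ≥ 3`. Suppose that (i) `E[p]` is an irreducible `Gal(ℚ̄/ℚ)`-representation; (ii) there exists a
prime `q ≠ p` at which `E` has multiplicative reduction and `E[p]` is ramified. If `L(E,1) ≠ 0`
then `|L(E,1)/Ω_E|_p⁻¹ = |#Ш(E) ∏_ℓ c_ℓ(E)|_p⁻¹`, and if `L(E,1) = 0` then `Sel_{p^∞}(E)` has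
`ℤ_p`-corank at least one." (Special case, for the newform of `E`, of Thm. B, p. 172, whose
hypothesis (iii) on the `𝓛`-invariant is known for elliptic curves; Thm. A = the cyclotomic
Iwasawa–Greenberg characteristic-ideal equality with `p ∣ N` allowed.) Only the first conclusion
is transcribed.
Translation (as in bsd.S30 `padicValRat_bsd_rank_zero`, of which this is the extension to
multiplicative `p` and to irreducible-plus-ramified instead of surjective image): `W` globally
minimal, so `W.realPeriodRat = Ω_E`; "good ordinary" = good reduction with `p ∤ a_p`
(`W.frobeniusTrace`); (ii) via Tate's parametrisation as `p ∤ v_q(Δ_min)` at a multiplicative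
`q ≠ p`; `∏_ℓ c_ℓ = W.tamagawaProduct` (`c_ℓ = 1` at good `ℓ`); `Finite W.sha` is carried as a
hypothesis so that `W.shaOrder = #Ш(E)` is a genuine order (a theorem here: `L(E,1) ≠ 0 ⇒ Ш(E)`
finite, bsd.S17 / Kato). The printed identity has no torsion term (a rational point of order `p`
would contradict (i)), and none is added.
[cite: Skinner2016PacificMC, Thm. C (p. 173)] -/
def Skinner2016_padicValRat_bsd_rank_zero : Prop :=
  ∀ (W : WeierstrassCurve ℚ) [W.IsElliptic] [W.IsGloballyMinimal] (p : ℕ) [Fact p.Prime]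
    (hp : 3 ≤ p)
    (hred : (W.HasGoodReductionAtPrime p ∧ ¬ (p : ℤ) ∣ W.frobeniusTrace p) ∨
      W.HasMultiplicativeReductionAtPrime p)
    (hirr : W.HasIrreducibleModPGaloisRep p)
    (hram : ∃ q : ℕ, ∃ _ : Fact q.Prime, q ≠ p ∧ W.HasMultiplicativeReductionAtPrime q ∧
      ¬ p ∣ padicValInt q W.minimalDiscriminantInt)
    (hL : W.entireLFunction 1 ≠ 0) (hfin : Finite W.sha),
    ∃ q : ℚ, W.entireLFunction 1 / (W.realPeriodRat : ℂ) = (q : ℂ) ∧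
      padicValRat p q = (padicValNat p W.shaOrder : ℤ) + padicValNat p W.tamagawaProduct

/-- **Jetchev–Skinner–Wan 2017, Thm. 1.2.1 (good ordinary `p`)** — D. Jetchev, C. Skinner,
X. Wan, *The Birch and Swinnerton-Dyer formula for elliptic curves of analytic rank one*, Camb. J.
Math. 5 (2017) 369–434, §1.2 and Thm. 1.2.1, p. 370, verbatim: "Let `E/ℚ` be a semistable
elliptic curve of conductor `N` (so `N` is square-free). Let `p ≥ 3` be a prime of good reduction
(i.e., `p ∤ N`) such that the mod `p` Galois representation `ρ̄_{E,p} : Gal(ℚ̄/ℚ) → Aut(E[p])` is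
irreducible. Suppose that `ord_{s=1} L(E/ℚ,s) = 1`. … Theorem 1.2.1 (`p`-part of the Birch and
Swinnerton-Dyer formula). If `p ≥ 5`, then (1.2.a)
`ord_p(L'(E,1)/(Reg(E/ℚ)·Ω_E)) = ord_p(#Ш(E/ℚ) ∏_{ℓ∤∞} c_ℓ(E/ℚ))`. If `p = 3`, then (1.2.a) holds
provided `a_p(E) = 0` when `E` has supersingular reduction at `p`." with (1.1.a), p. 370:
"`Ω_E = ∫_{E(ℝ)}|ω_E|` for `ω_E` a Néron differential", and "It is a consequence of the
Gross–Zagier formula that `L'(E/ℚ,1)/(Reg(E/ℚ)·Ω_E) ∈ ℚ^×`".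
RESTRICTION (this declaration): good ORDINARY `p ≥ 3` (`p ∤ a_p`), where the printed statement
applies at every `p ≥ 3` and its proof uses published inputs (Skinner–Urban 2014 / Skinner
2016 for the rank-`0` twist; Wan's Rankin–Selberg characteristic-ideal divisibility = X. Wan,
Algebra Number Theory 14 (2020) 383–483, Thm. 1.2 — printed for `p ≥ 5` ((a); (c) `ρ̄|_{G_𝒦}`
irreducible, (d) `∃ q ∥ N` non-split in `𝒦`, both met by JSW's auxiliary field; journal
p. 385–386, the version of record — the '2 splits in `𝒦`' / 'odd `q`, `ρ̄` ramified at `q`' clauses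
formerly quoted here are the superseded arXiv:1408.4044 text's) —, extended to
`p ≥ 3` by Castella–Liu–Wan, Forum Math. Sigma 10 (2022) e110, Thm. 8.2.1, modulo its
`2`-condition and the authors' 2024 addendum on [Hid04]; Bertolini–Darmon–Prasanna, Brooks,
Gross–Zagier–Kolyvagin, Yuan–Zhang–Zhang; the auxiliary Lemmas 9.5/9.6 of Skinner–Zhang,
arXiv:1407.1099, are unpublished — bypassable: JSW invoke them in §7.3.2 for the relation
(eq:period product) `Ω_f^cong ≐_p √|D| · Ω_E · Ω_{E^D}`, which follows instead from Zagier 1985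
(Canad. Math. Bull. 28, §1 p. 374: `4π² c² (f,f) = deg φ · covol(Λ_E)`), Pal 2012 (Proc. AMS 140,
Thm. 3.2 / Prop. 2.5) and Agashe–Ribet–Stein 2012 (Springer, doi:10.1007/978-1-4614-1260-1_2,
Thm. 2.1) with Mazur 1978 Cor. 4.1, by the tree theorem
`ModularForms.ModularParametrizationData.exists_rat_padicValRat_eq_zero_congruencePeriod_eq_of_ARS`
(`Literature/NumberTheory/EllipticCurves/CongruencePeriodTwistProductProofs.lean`, p479679: proved from
the tree theorems `ModularParametrizationData.zagier_degree_formula_holds` and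
`WeierstrassCurve.realPeriodRat_mul_sqrt_eq_of_twist_of_neg_of_squarefree`, with ARS Thm. 2.1 fed by
name as the refereed named fact `ModularForms.padicValNat_congruenceNumber_eq_of_not_sq_dvd`) in the
configuration JSW use (`N` square-free, `p` odd of good reduction, `K = ℚ(√D)` with `D < 0`
square-free, `D ≡ 1 (mod 4)` — referee C3 R419 Remark 2); so the Skinner–Zhang citation is historical
provenance only — ARM P reader r15 ADDENDUM-4, referee C3 R419 reading token
`JSW17-732-period-product@ARS12+Pal12(refereed; kernel p479679)`) — scope as read by the ARM P D-audit
of this binder, `pub/bsd-cited/sheets/D-AUDIT-r15.md` §0/§4 + ADDENDUM-1 §B (2026-08-26; statement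
VERBATIM, inputs graded there) + ADDENDUM-4 (period product re-sourced, 2026-08-27).
(Forum Math. Sigma 3 (2015) e18, formerly cited here, is Wan's Hilbert-modular-forms main
conjecture, not the Rankin–Selberg divisibility.)
The supersingular case of the printed theorem rests on Wan's signed-Selmer divisibility
[wan:kobayashi] = arXiv:1411.6352 (§1.2 p. 371 and
§7.4.4 (iii)), a preprint withdrawn from publication and superseded by Burungale–Skinner–Tian–Wan,
arXiv:2409.01350 (2024, preprint; Rem. 1.4 (i)); it is NOT vendored (see the module docstring's
TODO). Translation: `E` semistable = `W.IsSemistable ℤ`; `ord_{s=1} L(E,s) = 1` is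
`W.analyticRank = 1`, and then `W.leadingLCoeff = L'(E,1)`; `∏_{ℓ∤∞} c_ℓ = W.tamagawaProduct`;
`Finite W.sha` as in bsd.S30 (a theorem in analytic rank `1`, bsd.S17); `L'(E,1)/(Reg·Ω_E) ∈ ℚ^×`
is part of the printed claim (Gross–Zagier), whence the `∃ q : ℚ`. (The multiplicative case
`p ∣ N` is NOT covered: §7.4.4 (v) "can likely be relaxed to … multiplicative reduction" is a
remark, and Castella 2018 Thm. A, which claimed it, is withdrawn for `p ‖ N` by its author's
erratum — see the module docstring.)
[cite: JetchevSkinnerWan2017, Thm. 1.2.1 (p. 370), §7.4.4] -/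
def JetchevSkinnerWan2017_padicValRat_bsd_rank_one_ordinary : Prop :=
  ∀ (W : WeierstrassCurve ℚ) [W.IsElliptic] [W.IsGloballyMinimal] (p : ℕ) [Fact p.Prime]
    (hp : 3 ≤ p) (hss : W.IsSemistable ℤ) (hgood : W.HasGoodReductionAtPrime p)
    (hord : ¬ (p : ℤ) ∣ W.frobeniusTrace p) (hirr : W.HasIrreducibleModPGaloisRep p)
    (hrk : W.analyticRank = 1) (hfin : Finite W.sha),
    ∃ q : ℚ, W.leadingLCoeff / ((W.regulator : ℂ) * (W.realPeriodRat : ℂ)) = (q : ℂ) ∧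
      padicValRat p q = (padicValNat p W.shaOrder : ℤ) + padicValNat p W.tamagawaProduct

/-- **Wuthrich 2014, Prop. 21** — C. Wuthrich, *On the integrality of modular symbols and Kato's
Euler system for elliptic curves*, Doc. Math. 19 (2014) 381–402, Prop. 21, p. 400, verbatim:
"Let `E` be an elliptic curve over `ℚ` such that `L(E,1) ≠ 0`. Let `c_v` be the Tamagawa number
of `E` at each finite place `v` and the number of components in `E(ℝ)` for `v = ∞`. Then `#Ш(E/ℚ)`
divides `C · (L(E,1)/Ω⁺_E) · (#E(ℚ))² / ∏_v c_v` where `C` is a rational number only divisible by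
`2`, primes of additive reduction or primes for which the Galois representation on `E[p]` is
neither surjective nor contained in a Borel subgroup. In particular, for semi-stable curve `C` is a
power of `2`." (the paper's "usual application to … Birch and Swinnerton-Dyer" of the
integrality of Kato's Euler system, Thm. 16 / Cor. 19 of the paper — stated there as Prop. 21, the
standard consequence of Thm. 16 / Cor. 19 and Kato's bound, printed WITHOUT a proof: p. 400 "Finally,
here is the usual application to the Birch and Swinnerton-Dyer conjecture … The methods in [26] can
now be extended to the reducible case, too", [26] = Stein–Wuthrich, Math. Comp. 82 (2013); wording
corrected per ARM P D-AUDIT-r06-Q05 §S4, sheet 1c89d2a117df06db, 2026-08-26 — the earlier text said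
"a THEOREM, proved there"; no hypothesis on the prime.)
Translation: `Ω⁺_E` is "the minimal absolute value of non-zero elements in `L_E` on the real axis"
(p. 382, `L_E` the Néron lattice), so `(L(E,1)/Ω⁺_E)/c_∞ = L(E,1)/Ω_E` with the tree's
`Ω_E = W.realPeriodRat = c_∞ Ω⁺_E` (`W` globally minimal), and the remaining product is the finite
Tamagawa product `W.tamagawaProduct`; `#E(ℚ) = #E(ℚ)_tors = W.torsionOrder`, `E(ℚ)` being finite
when `L(E,1) ≠ 0` (Kolyvagin; bsd.S17); `Finite W.sha` is carried as in bsd.S30 (a theorem here)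
so that `W.shaOrder = #Ш(E/ℚ)`; "`C` only divisible by" the listed primes = every prime `p` with
`ord_p C ≠ 0` is `2`, or a prime of additive (= neither good nor multiplicative) reduction, or one
at which `ρ̄_{E,p}` is neither surjective nor reducible ("contained in a Borel subgroup" = `E[p]`
has a `Γ_ℚ`-stable line = `¬ HasIrreducibleModPGaloisRep`), and `C ≠ 0` (a zero `C` would make
the divisibility void); "`#Ш` divides the rational number `x`" = `x ∈ #Ш · ℤ`. Consequence used by
the census (row `T-WU14` / lever L1): at an odd prime `p` of non-additive reduction with `ρ̄_{E,p}`
surjective or reducible, `ord_p #Ш(E/ℚ) ≤ ord_p (L(E,1)/Ω_E · #E(ℚ)²_tors / ∏_ℓ c_ℓ)`.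
[cite: Wuthrich2014, Prop. 21 (p. 400); §1 (p. 382)] -/
def Wuthrich2014_shaOrder_dvd_of_L_one_ne_zero : Prop :=
  ∀ (W : WeierstrassCurve ℚ) [W.IsElliptic] [W.IsGloballyMinimal]
    (hL : W.entireLFunction 1 ≠ 0) (hfin : Finite W.sha),
    ∃ q C : ℚ, W.entireLFunction 1 / (W.realPeriodRat : ℂ) = (q : ℂ) ∧ C ≠ 0 ∧
      (∀ (p : ℕ) [Fact p.Prime], padicValRat p C ≠ 0 →
        p = 2 ∨ (¬ W.HasGoodReductionAtPrime p ∧ ¬ W.HasMultiplicativeReductionAtPrime p) ∨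
          (¬ W.HasSurjectiveModNGaloisRep p ∧ W.HasIrreducibleModPGaloisRep p)) ∧
      ∃ m : ℤ, C * q * (W.torsionOrder : ℚ) ^ 2 / (W.tamagawaProduct : ℚ) = (m : ℚ) * (W.shaOrder : ℚ)

/-- **W. Zhang 2014, Thm. 1.6 with the hypotheses of Thm. 1.4 (good ordinary `p ≥ 5`, any
conductor)** — W. Zhang, *Selmer groups and the indivisibility of Heegner points*, Camb. J. Math.
2 (2014) 191–253. Standing assumptions, p. 193, verbatim: "Throughout this paper we assume that
`ρ̄_{E,p}` is surjective, `p ∤ N`, and `p ≥ 5`." Thm. 1.4, p. 197, verbatim: "Let `E/ℚ` be an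
elliptic curve of conductor `N`, and `p ≥ 5` a prime such that: (1) `ρ̄_{E,p}` is surjective.
(2) If `ℓ ≡ ±1 mod p` and `ℓ ∥ N`, then `ρ̄_{E,p}` is ramified at `ℓ`. (3) If `N` is not
square-free, then `#Ram(ρ̄_{E,p}) ≥ 1` and when `#Ram(ρ̄_{E,p}) = 1`, there are even number of
prime factors `ℓ ∥ N`. (4) The prime `p` is good ordinary.", where (p. 194) "Let `Ram(ρ̄_{E,p})`
be the set of primes `ℓ ∥ N` such that `ρ̄_{E,p}` is ramified at `ℓ`." Remark 3, p. 198: "For an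
elliptic curve `E/ℚ`, the set of primes `p` satisfying (1)-(4) in Theorem 1.4 has density one".
**Thm. 1.6, p. 199**, a THEOREM, verbatim: "Let `(E, p)` be as in Theorem 1.4. If
`ord_{s=1} L(E/ℚ, s) = 1`, then the `p`-part of the B-SD formula for `E/ℚ` holds:
`|L'(E/ℚ,1)/(Ω_E · Reg(E/ℚ))|_p = |#Ш(E/ℚ) · ∏_{ℓ∣N} c_ℓ|_p`, where the regulator is defined by
`Reg(E/ℚ) := ⟨y,y⟩_{NT}/[E(ℚ):ℤy]²` for any non-torsion `y ∈ E(ℚ)`, `⟨y,y⟩_{NT}` is the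
Néron–Tate height pairing, and `c_ℓ` is the local Tamagawa number of `E/ℚ_ℓ`." Proof in §10 of
the paper (Thm. 10.3) from its Thm. 1.1, the Gross–Zagier formula of Yuan–Zhang–Zhang,
Kolyvagin's theorem and, for a suitable quadratic twist, "the theorem of Kato and Skinner–Urban on
the B-SD formula in the rank zero case" (Remark 5, p. 199); Remark 4 compares with Skinner–Urban
Thm. 2 (= bsd.S30).
Translation (currency of this file): `W` globally minimal, `W.realPeriodRat = Ω_E`;
(1) = `W.HasSurjectiveModNGaloisRep p`; (4) = good reduction at `p` with `p ∤ a_p`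
(`W.frobeniusTrace`); "`ℓ ∥ N`" = multiplicative reduction at `ℓ`, and for such `ℓ` (necessarily
`ℓ ≠ p`, `p` being good) "`ρ̄_{E,p}` ramified at `ℓ`" ⟺ `p ∤ v_ℓ(Δ_min)` (Tate's parametrisation,
as `haux` in bsd.S30 and `hram` in `Skinner2016_padicValRat_bsd_rank_zero`; Bhargava–Skinner–Zhang
2014, Remark 7), so (2) = `h2` with "`ℓ ≡ ±1 mod p`" written `p ∣ ℓ - 1 ∨ p ∣ ℓ + 1`, and
`Ram(ρ̄_{E,p})` = the set of multiplicative primes `ℓ` with `p ∤ v_ℓ(Δ_min)`; "`N` is not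
square-free" = `¬ W.IsSemistable ℤ`, so (3) = `h3` (nonempty `Ram`, and `#Ram = 1 ⇒` an even
number of multiplicative primes; `Set.ncard`, both sets being finite — primes dividing `Δ`);
`ord_{s=1} L(E/ℚ,s) = 1` is `W.analyticRank = 1`, whence `W.leadingLCoeff = L'(E/ℚ,1)`;
`∏_{ℓ∣N} c_ℓ = W.tamagawaProduct`; `Finite W.sha` carried as in bsd.S30 (a theorem in analytic
rank one, bsd.S17) so that `W.shaOrder = #Ш(E/ℚ)`. Zhang's `Reg(E/ℚ)` equals
`W.regulator / (#E(ℚ)_tors)²` when `rk E(ℚ) = 1` (write `E(ℚ) = ℤg ⊕ T`, `y = mg + t`: then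
`⟨y,y⟩ = m²⟨g,g⟩` and `[E(ℚ):ℤy] = m·#T`), so the printed identity is
`ord_p(L'(E,1)/(Reg·Ω_E)) = ord_p(#Ш ∏ c_ℓ) - 2·ord_p(#E(ℚ)_tors)` with the standard regulator
`W.regulator` and `#E(ℚ)_tors = W.torsionOrder`; the torsion term is a `p`-adic unit under (1) but
is kept, so that nothing printed is dropped; `L'(E/ℚ,1)/(Reg·Ω_E) ∈ ℚ^×` (Gross–Zagier) gives the
`∃ q : ℚ` as in `JetchevSkinnerWan2017_padicValRat_bsd_rank_one_ordinary`. Not a restatement of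
that fact (no semistability here; surjectivity and (2)–(3) instead) nor of
`BurungaleCastellaSkinner2025.cor131_padicValRat_bsd_rank_le_one` (different hypotheses and a
different, Beilinson–Flach-free, proof in print).
[cite: WZhang2014, Thm. 1.6 (p. 199), Thm. 1.4 (p. 197), p. 193, Remark 3 (p. 198)] -/
def WZhang2014_padicValRat_bsd_rank_one_ordinary : Prop :=
  ∀ (W : WeierstrassCurve ℚ) [W.IsElliptic] [W.IsGloballyMinimal] (p : ℕ) [Fact p.Prime]
    (hp : 5 ≤ p) (hgood : W.HasGoodReductionAtPrime p) (hord : ¬ (p : ℤ) ∣ W.frobeniusTrace p)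
    (hsurj : W.HasSurjectiveModNGaloisRep p)
    (h2 : ∀ (ℓ : ℕ) [Fact ℓ.Prime], W.HasMultiplicativeReductionAtPrime ℓ →
      (p ∣ ℓ - 1 ∨ p ∣ ℓ + 1) → ¬ p ∣ padicValInt ℓ W.minimalDiscriminantInt)
    (h3 : ¬ W.IsSemistable ℤ →
      (∃ ℓ : ℕ, ∃ _ : Fact ℓ.Prime, W.HasMultiplicativeReductionAtPrime ℓ ∧
          ¬ p ∣ padicValInt ℓ W.minimalDiscriminantInt) ∧
        (Set.ncard {ℓ : ℕ | ∃ _ : Fact ℓ.Prime, W.HasMultiplicativeReductionAtPrime ℓ ∧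
            ¬ p ∣ padicValInt ℓ W.minimalDiscriminantInt} = 1 →
          Even (Set.ncard {ℓ : ℕ | ∃ _ : Fact ℓ.Prime, W.HasMultiplicativeReductionAtPrime ℓ})))
    (hrk : W.analyticRank = 1) (hfin : Finite W.sha),
    ∃ q : ℚ, W.leadingLCoeff / ((W.regulator : ℂ) * (W.realPeriodRat : ℂ)) = (q : ℂ) ∧
      padicValRat p q = (padicValNat p W.shaOrder : ℤ) + padicValNat p W.tamagawaProduct
        - 2 * (padicValNat p W.torsionOrder : ℤ)

end PPartRankLeOne

end Literature.NumberTheory.EllipticCurves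

end
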